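import Literature.AnabelianGeometry.SemiGraphs.TemperedCuspOmissionHypotheses
import Literature.AnabelianGeometry.SemiGraphs.TemperedDecompositionEmbedding
import Literature.AnabelianGeometry.SemiGraphs.TemperedDecompositionSubgroupsProfinitelyClosedOfInducing
import Literature.AnabelianGeometry.SemiGraphs.PiPresentationBridgeQuasiCoherent
import Literature.AnabelianGeometry.SemiGraphs.PiPresentationBridgeElevated
import Literature.AnabelianGeometry.SemiGraphs.TemperedDecompositionSingleVertex
import Literature.AnabelianGeometry.SemiGraphs.OneVertexEdgelessHypotheses
import HarnessLib

/-!
# The hypotheses of [SemiAnbd] Prop. 3.6 / Thm. 3.7 pass to the restriction to ANY connected sub-semi-graph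
# with a vertex; the decomposition groups `Π^tp_ℍ ⊆ Π^tp_𝔾` of [IUTchI] §2 with no `𝒢_ℍ`-side binder

Mochizuki, *Semi-graphs of anabelioids*, Publ. RIMS **42** (2006) [MochizukiSemiAnbd2006], Def. 2.1 p. 24
("`(𝒢_ℍ)_c := 𝒢_c`", the restriction to a sub-semi-graph), Def. 2.3 (iii) p. 25 (quasi-coherent, coherent),
Prop. 2.5 (i) p. 27 (proof: "any finite étale covering of `𝒢_ℍ` may be split by a finite étale covering
pulled back from `𝒢`"), Prop. 3.6 p. 38 / Thm. 3.7 p. 40 (the hypothesis bundles `Prop36Hypotheses` /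
`Thm37Hypotheses`) [cite: MochizukiSemiAnbd2006, Prop 2.5(i) p.27]; Mochizuki, *Inter-universal Teichmüller
theory I*, §2 p. 44 l. 39–44 (for a [connected] sub-semi-graph `ℍ ⊆ 𝔾` "we obtain natural … decomposition
groups `Π^tp_ℍ ⊆ Π^tp_𝔾`, `Π̂_ℍ ⊆ Π̂_𝔾` … inclusions … of topological groups"), Prop. 2.2 p. 45, Rmk. 2.5.3 (i)
(T2) p. 52 (Galois-countability) [cite: Mochizuki2012, IUTchI §2 p.44] [claim: Mochizuki2012, status: disputed]
(nothing of the [IUTchI] series is asserted; proved are the displayed statements about the tree's objects).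

PROOF-ONLY sequel (abc-iut cell; row «DECOMP-L5-MERGE», seat abc-iut-w4-d052 gen 6; L3 → L5 cone §2) of
`TemperedCuspOmissionHypotheses.lean` (abc-iut-f-177: the bundles restrict along a CUSP OMISSION) and of the
DECOMP chain of record ((FIN) `finiteRestrictSplits` → (DOM) → (EMB) → capstone `IsDecompHom.isInducing`,
`TemperedDecompositionEmbedding.lean`; (P3) `isCommensurablyTerminal_topologicalClosure_map_of_mem_decompSubgroups`;
(P1) `comap_topologicalClosure_map_eq_of_mem_decompSubgroups_of_isInducing`).  The consumers of that chain
still bind the bundle `h37H : (𝒢.restrict ℍ).Thm37Hypotheses` of the RESTRICTED semi-graph and the two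
p. 44 "cusp-omission atoms" `hq` / `hel` in the §2 presentation.  Here all three are DERIVED:

* §1 `IsQuasiCoherent.restrictSub`, `IsCoherent.restrictSub` — quasi-coherence / coherence restrict to ANY
  sub-semi-graph (prescribe the given coverings over `ℍ`, the EMPTY covering elsewhere; restrict the
  approximator, `Approximator.restrictSub`);
* §2 **`IsGaloisCountable.restrictSub`** — for `𝒢` Galois-countable and quasi-coherent and `ℍ` CONNECTED,
  `𝒢_ℍ` is Galois-countable: restrict the countable splitting family of `𝒢`; a finite covering of `𝒢_ℍ` is
  split by the restriction of a finite covering of `𝒢` (Prop. 2.5 (i) first reduction =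
  `exists_finite_covRestrict_splits_of_card_le`, the (FIN) engine), which is split by a member of the family,
  and splitting restricts (`Splits.covRestrict`) and is transitive through nonempty fibres;
* §3 **`Prop36Hypotheses.restrictSub`, `Thm37Hypotheses.restrictSub`** — the bundles pass to `𝒢_ℍ` for every
  sub-semi-graph `ℍ` that is CONNECTED and HAS A VERTEX (print's standing shape of `ℍ`);
* §4 `Prop36Hypotheses.isQuasiCoherent_toAnab_maximalSubgraph` / `…isElevated_toAnab_maximalSubgraph` — the
  p. 44 atoms `hq` / `hel` of the (P3)/(P2) files from `Prop36Hypotheses` of `𝒢` alone, via the so far unused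
  §3 ⇒ §2 bridges `isQuasiCoherent_toAnab` / `isElevatedVertex_toAnab` and the cusp-omission transfer;
* §5 the DECOMP chain with the `𝒢_ℍ`-side binders gone: `IsDecompHom.isInducing_of_isConnected`,
  `decompSubgroupsCommensurablyTerminal_of_isConnected` ([IUTchI] Prop. 2.2 third inclusion, general `ℍ`),
  `isClosed_of_mem_decompSubgroups_of_isConnected`,
  `isCommensurablyTerminal_topologicalClosure_map_of_mem_decompSubgroups_of_prop36` (`hhat`), and
  `comap_topologicalClosure_map_eq_of_mem_decompSubgroups_of_isCoherent` ([IUTchI] Cor. 2.3 (v) input) — every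
  one reading only the bundle of `𝒢` (+ coherence / a closed edge for the last) and "`ℍ` connected with a
  vertex";
* §6 `isCommensurablyTerminal_topologicalClosure_map_of_mem_verticialSubgroups` — the same `hhat` for every
  VERTICIAL subgroup `Π_v` (the single-vertex sub-semi-graph `⟨{v}, ∅⟩` is connected with a vertex and its
  decomposition subgroups are the verticial subgroups at `v`, `decompSubgroups_singleVertex_eq_of_prop36`):
  the `hhat` law of the `ℍ = {v}` rows of [IUTchI] Cor. 2.3 from `Prop36Hypotheses` of `𝒢` alone.

Theorems only: no `def`, no instance, no new `Prop` fact; nothing here bears on [IUTchIII] Cor. 3.12 or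
asserts that abc is proved or refuted.
-/

noncomputable section

namespace Literature.AnabelianGeometry.SemiGraphs

namespace ProfiniteSemiGraph

open CategoryTheory _root_.Topology
open Literature.AnabelianGeometry.AbsoluteAnabelian (IsCommensurablyTerminal)

universe u v

variable {𝒢 : ProfiniteSemiGraph.{u}}

/-! ### §1 Quasi-coherence and coherence restrict to any sub-semi-graph -/

/-- Transport of "`g` acts trivially" along an equality of tempered objects (bookkeeping).
[cite: MochizukiSemiAnbd2006, Def 2.3(iii) p.25] -/
private theorem fixes_transport {G : Type u} [Group G] [TopologicalSpace G] {Y Z : BTemp G}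
    (hYZ : Y = Z) (g : G) (hY : ∀ s : Y.obj.V, Y.obj.ρ g s = s) : ∀ s : Z.obj.V, Z.obj.ρ g s = s := by
  subst hYZ
  exact hY

/-- **Quasi-coherence restricts to ANY sub-semi-graph** (Def. 2.3 (iii)): prescribe the given finite
coverings over the components of `ℍ` and the EMPTY covering over every other component of `𝔾`, approximate
in `𝒢`, restrict the approximator. [cite: MochizukiSemiAnbd2006, Def 2.3(iii) p.25] -/
theorem IsQuasiCoherent.restrictSub (h : 𝒢.IsQuasiCoherent) (H : 𝒢.graph.Subgraph) :
    (𝒢.restrict H).IsQuasiCoherent := by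
  classical
  intro M HV HE hV hE
  let HV' : ∀ v : 𝒢.graph.Vertex, BTemp (𝒢.Gv v) := fun v =>
    if hv : v ∈ H.verts then HV ⟨v, hv⟩ else BTemp.trivialObj (𝒢.Gv v) PEmpty
  let HE' : ∀ e : 𝒢.graph.Edge, BTemp (𝒢.Ge e) := fun e =>
    if he : e ∈ H.edges then HE ⟨e, he⟩ else BTemp.trivialObj (𝒢.Ge e) PEmpty
  have hV' : ∀ v, Nat.card (HV' v).obj.V ≤ M ∧ Finite (HV' v).obj.V := by
    intro v
    by_cases hv : v ∈ H.verts
    · have heq : HV' v = HV ⟨v, hv⟩ := dif_pos hv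
      rw [heq]
      exact hV ⟨v, hv⟩
    · have heq : HV' v = BTemp.trivialObj (𝒢.Gv v) PEmpty := dif_neg hv
      rw [heq]
      exact ⟨by simp [BTemp.trivialObj], inferInstanceAs (Finite PEmpty)⟩
  have hE' : ∀ e, Nat.card (HE' e).obj.V ≤ M ∧ Finite (HE' e).obj.V := by
    intro e
    by_cases he : e ∈ H.edges
    · have heq : HE' e = HE ⟨e, he⟩ := dif_pos he
      rw [heq]
      exact hE ⟨e, he⟩
    · have heq : HE' e = BTemp.trivialObj (𝒢.Ge e) PEmpty := dif_neg he
      rw [heq]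
      exact ⟨by simp [BTemp.trivialObj], inferInstanceAs (Finite PEmpty)⟩
  obtain ⟨A, hAV, hAE⟩ := h M HV' HE' hV' hE'
  refine ⟨A.restrictSub H, fun v g hg => ?_, fun e g hg => ?_⟩
  · exact fixes_transport (dif_pos v.2 : HV' v.1 = HV v) g (hAV v.1 g hg)
  · exact fixes_transport (dif_pos e.2 : HE' e.1 = HE e) g (hAE e.1 g hg)

/-- **Coherence restricts to ANY sub-semi-graph** (Def. 2.3 (iii): quasi-coherent with topologically
finitely generated constituents — the constituents of `𝒢_ℍ` are among those of `𝒢`).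
[cite: MochizukiSemiAnbd2006, Def 2.3(iii) p.25] -/
theorem IsCoherent.restrictSub (h : 𝒢.IsCoherent) (H : 𝒢.graph.Subgraph) : (𝒢.restrict H).IsCoherent :=
  ⟨h.1.restrictSub H, fun v => h.2.1 v.1, fun e => h.2.2 e.1⟩

/-! ### §2 Galois-countability restricts to a connected sub-semi-graph -/

/-- A uniform positive bound for the fibres of ANY finite covering of a CONNECTED semi-graph (all fibres
have one cardinality; no nonempty-fibre hypothesis). [cite: MochizukiSemiAnbd2006, §3 p.36] -/
theorem CovObj.exists_pos_card_le_of_isConnected (hc : 𝒢.graph.IsConnected) (F : CovObj 𝒢)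
    (hFfin : F.IsFinite) :
    ∃ M : ℕ, 0 < M ∧ (∀ v, Finite (F.SV v).obj.V ∧ Nat.card (F.SV v).obj.V ≤ M) ∧
      ∀ e, Finite (F.SE e).obj.V ∧ Nat.card (F.SE e).obj.V ≤ M := by
  obtain ⟨n⟩ := hc.connected.nonempty
  refine ⟨Sum.elim (fun v => Nat.card (F.SV v).obj.V) (Sum.elim (fun e => Nat.card (F.SE e).obj.V)
      (fun b => Nat.card (F.SE (𝒢.graph.edgeOf b)).obj.V)) n + 1, Nat.succ_pos _,
    fun v => ⟨hFfin.finite_V v, ?_⟩, fun e => ⟨hFfin.finite_E e, ?_⟩⟩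
  · exact (F.natCard_node_eq_of_isConnected hc (Sum.inl v) n).le.trans (Nat.le_succ _)
  · exact (F.natCard_node_eq_of_isConnected hc (Sum.inr (Sum.inl e)) n).le.trans (Nat.le_succ _)

/-- **Galois-countability passes to a CONNECTED sub-semi-graph of a quasi-coherent `𝒢`** ([IUTchI]
Rmk. 2.5.3 (i) (T2); [SemiAnbd] Prop. 2.5 (i) first reduction): the family `{G_i|_ℍ}` of restrictions of the
countable splitting family of `𝒢` splits every finite étale covering `Y` of `𝒢_ℍ` — `Y` is split by the
restriction `X|_ℍ` of a finite covering `X` of `𝒢` with nonempty fibres (quasi-coherence, the trivialising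
covering of an approximator: `exists_finite_covRestrict_splits_of_card_le`), `X` by some `G_i`, and splitting
restricts and is transitive through `X|_ℍ`. [cite: Mochizuki2012, IUTchI Rmk 2.5.3 (i) (T2), p. 52] -/
theorem IsGaloisCountable.restrictSub (hgc : 𝒢.IsGaloisCountable) (hqc : 𝒢.IsQuasiCoherent)
    (H : 𝒢.graph.Subgraph) (hH : (𝒢.restrict H).IsConnected) : (𝒢.restrict H).IsGaloisCountable := by
  obtain ⟨hc, F, hF, hsplit⟩ := hgc
  refine ⟨hc.restrictSub H, fun i => (𝒢.covRestrict H).obj (F i),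
    fun i => ⟨(hF i).1.covRestrict H, (hF i).2.covRestrict H⟩, fun Y hY => ?_⟩
  obtain ⟨M, hM, hV, hE⟩ := Y.exists_pos_card_le_of_isConnected hH hY
  obtain ⟨X, hXfin, hXne, -, hXspl⟩ := exists_finite_covRestrict_splits_of_card_le hqc H Y hM hV hE
  obtain ⟨i, hi⟩ := hsplit X hXfin
  exact ⟨i, (hi.covRestrict H).trans_of_hasNonemptyFibres (hXne.covRestrict H) hXspl⟩

/-! ### §3 The bundles of Prop. 3.6 / Thm. 3.7 restrict to a connected sub-semi-graph with a vertex -/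

/-- **The hypotheses of [SemiAnbd] Prop. 3.6 pass to `𝒢_ℍ` for every CONNECTED sub-semi-graph `ℍ` with a
VERTEX** (connectedness and the vertex are exactly print's standing shape of `ℍ`; everything else
restricts). [cite: MochizukiSemiAnbd2006, Prop 3.6 p.38] -/
theorem Prop36Hypotheses.restrictSub (h : 𝒢.Prop36Hypotheses) (H : 𝒢.graph.Subgraph)
    (hconn : (𝒢.restrict H).IsConnected) (hv : (𝒢.restrict H).HasVertex) :
    (𝒢.restrict H).Prop36Hypotheses where
  isConnected := hconn
  isCountable := h.isCountable.restrictSub H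
  isGaloisCountable := h.isGaloisCountable.restrictSub h.isQuasiCoherent H hconn
  hasVertex := hv
  isOfInjectiveType := h.isOfInjectiveType.restrictSub H
  isQuasiCoherent := h.isQuasiCoherent.restrictSub H
  isTotallyElevated := h.isTotallyElevated.restrictSub H
  isTotallyAloof := h.isTotallyAloof.restrictSub H
  isVerticiallySlim := h.isVerticiallySlim.restrictSub H

/-- **The hypotheses of [SemiAnbd] Thm. 3.7 pass to `𝒢_ℍ` for every CONNECTED sub-semi-graph `ℍ` with a
VERTEX.** [cite: MochizukiSemiAnbd2006, Thm 3.7 p.40] -/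
theorem Thm37Hypotheses.restrictSub (h : 𝒢.Thm37Hypotheses) (H : 𝒢.graph.Subgraph)
    (hconn : (𝒢.restrict H).IsConnected) (hv : (𝒢.restrict H).HasVertex) :
    (𝒢.restrict H).Thm37Hypotheses where
  toProp36Hypotheses := h.toProp36Hypotheses.restrictSub H hconn hv
  isTotallyEstranged := h.isTotallyEstranged.restrictSub H

/-- A sub-semi-graph with a vertex has a vertex (bookkeeping form of `HasVertex` from a named vertex of `ℍ`).
[cite: MochizukiSemiAnbd2006, Thm 3.7 p.40] -/
theorem hasVertex_restrict_of_mem {H : 𝒢.graph.Subgraph} {v : 𝒢.graph.Vertex} (hv : v ∈ H.verts) :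
    (𝒢.restrict H).HasVertex :=
  ⟨⟨v, hv⟩⟩

/-! ### §4 The p. 44 cusp-omission atoms `hq` / `hel` from the bundle of `𝒢` -/

/-- **The atom `hq`**: for `𝒢` satisfying the hypotheses of Prop. 3.6, the cusp-omitted semi-graph of
anabelioids `𝒢_{𝔾_max}` (§2 presentation) is quasi-coherent — quasi-coherence passes to the cusp omission
`𝔾_max` (`IsQuasiCoherent.restrict_of_isCuspOmission`) and from the §3 to the §2 rendering
(`isQuasiCoherent_toAnab`). [cite: MochizukiSemiAnbd2006, Def 2.3(iii) p.25] -/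
theorem Prop36Hypotheses.isQuasiCoherent_toAnab_maximalSubgraph (h36 : 𝒢.Prop36Hypotheses) :
    (𝒢.toAnab.restrict 𝒢.toAnab.graph.maximalSubgraph).IsQuasiCoherent :=
  (𝒢.restrict 𝒢.graph.maximalSubgraph).isQuasiCoherent_toAnab
    (h36.isOfInjectiveType.restrictSub _)
    (h36.isQuasiCoherent.restrict_of_isCuspOmission h36.maximalSubgraph_isCuspOmission)

/-- **The atom `hel`**: for `𝒢` satisfying the hypotheses of Prop. 3.6, every vertex of the cusp-omitted
semi-graph of anabelioids `𝒢_{𝔾_max}` (§2 presentation) is elevated (`IsTotallyElevated.restrictSub`, then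
`isElevatedVertex_toAnab`). [cite: MochizukiSemiAnbd2006, Def 2.4(i) p.25] -/
theorem Prop36Hypotheses.isElevated_toAnab_maximalSubgraph (h36 : 𝒢.Prop36Hypotheses)
    (v : 𝒢.graph.Vertex) :
    (𝒢.toAnab.restrict 𝒢.toAnab.graph.maximalSubgraph).IsElevated ⟨v, Set.mem_univ v⟩ :=
  (𝒢.restrict 𝒢.graph.maximalSubgraph).isElevatedVertex_toAnab ⟨v, Set.mem_univ v⟩
    ((h36.isTotallyElevated.restrictSub _) ⟨v, Set.mem_univ v⟩)

/-! ### §5 The DECOMP chain with no `𝒢_ℍ`-side binder -/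

namespace TemperedPiChart

variable {c : TemperedPiChart 𝒢} {H : 𝒢.graph.Subgraph}

/-- **THE EMBEDDING, for `ℍ` connected with a vertex** ([IUTchI] §2 p. 44 "inclusions … of topological
groups"): every decomposition homomorphism `φ : π₁^temp(𝒢_ℍ) → π₁^temp(𝒢)` induces the topology — the
capstone `IsDecompHom.isInducing` with `h37H := h37.restrictSub`. [cite: Mochizuki2012, IUTchI §2 p.44] -/
theorem IsDecompHom.isInducing_of_isConnected (h37 : 𝒢.Thm37Hypotheses)
    (hconn : (𝒢.restrict H).IsConnected) (hv : (𝒢.restrict H).HasVertex)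
    {c' : TemperedPiChart (𝒢.restrict H)} {φ : c'.G →ₜ* c.G} (hφ : c.IsDecompHom H c' φ) :
    IsInducing φ :=
  hφ.isInducing h37 (h37.restrictSub H hconn hv)

/-- … and is a CLOSED EMBEDDING. [cite: Mochizuki2012, IUTchI §2 p.44] -/
theorem IsDecompHom.isClosedEmbedding_of_isConnected (h37 : 𝒢.Thm37Hypotheses)
    (hconn : (𝒢.restrict H).IsConnected) (hv : (𝒢.restrict H).HasVertex)
    {c' : TemperedPiChart (𝒢.restrict H)} {φ : c'.G →ₜ* c.G} (hφ : c.IsDecompHom H c' φ) :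
    IsClosedEmbedding φ :=
  hφ.isClosedEmbedding h37 (h37.restrictSub H hconn hv)

/-- **[IUTchI] Prop. 2.2, third inclusion, for a GENERAL connected sub-semi-graph `ℍ` with a vertex**:
every decomposition subgroup `Π^tp_ℍ ∈ decompSubgroups c ℍ` is commensurably terminal in `π₁^temp(𝒢)` —
binders: the Thm. 3.7 bundle of `𝒢`, Thm. 3.7 (iii) at `𝒢_ℍ` (`hCIV`; gone for finite `ℍ` below).
[cite: Mochizuki2012, IUTchI Prop 2.2 p.45] -/
theorem decompSubgroupsCommensurablyTerminal_of_isConnected (h37 : 𝒢.Thm37Hypotheses)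
    (hconn : (𝒢.restrict H).IsConnected) (hv : (𝒢.restrict H).HasVertex)
    (hCIV : CompactInVerticialAt (𝒢.restrict H)) : c.DecompSubgroupsCommensurablyTerminal H :=
  decompSubgroupsCommensurablyTerminal h37 (h37.restrictSub H hconn hv) hCIV

/-- **… for FINITE `ℍ`**: the ONLY binder is the Thm. 3.7 bundle of `𝒢`.
[cite: Mochizuki2012, IUTchI Prop 2.2 p.45] -/
theorem decompSubgroupsCommensurablyTerminal_of_isConnected_of_finite [Finite H.toSemiGraph.Vertex]
    [Finite H.toSemiGraph.Edge] (h37 : 𝒢.Thm37Hypotheses) (hconn : (𝒢.restrict H).IsConnected)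
    (hv : (𝒢.restrict H).HasVertex) : c.DecompSubgroupsCommensurablyTerminal H :=
  decompSubgroupsCommensurablyTerminal_of_finite h37 (h37.restrictSub H hconn hv)

/-- The commensurator form `C_{π₁^temp(𝒢)}(D) = D`, finite connected `ℍ` with a vertex.
[cite: Mochizuki2012, IUTchI Prop 2.2 p.45] -/
theorem commensurator_eq_of_mem_decompSubgroups_of_isConnected [Finite H.toSemiGraph.Vertex]
    [Finite H.toSemiGraph.Edge] (h37 : 𝒢.Thm37Hypotheses) (hconn : (𝒢.restrict H).IsConnected)
    (hv : (𝒢.restrict H).HasVertex) {D : Subgroup c.G} (hD : D ∈ c.decompSubgroups H) :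
    Subgroup.Commensurable.commensurator D = D :=
  commensurator_eq_of_mem_decompSubgroups h37 (h37.restrictSub H hconn hv) hD

/-- Every decomposition subgroup of a connected `ℍ` with a vertex is CLOSED in `π₁^temp(𝒢)`.
[cite: Mochizuki2012, IUTchI §2 p.44] -/
theorem isClosed_of_mem_decompSubgroups_of_isConnected (h37 : 𝒢.Thm37Hypotheses)
    (hconn : (𝒢.restrict H).IsConnected) (hv : (𝒢.restrict H).HasVertex) {D : Subgroup c.G}
    (hD : D ∈ c.decompSubgroups H) : IsClosed (D : Set c.G) :=
  isClosed_of_mem_decompSubgroups h37 (h37.restrictSub H hconn hv) hD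

/-- **`hhat` — `Π̂_ℍ := closure ι(Π^tp_ℍ)` is commensurably terminal in `Π̂_𝔾`** ([IUTchI] Prop. 2.2 proof
p. 46 l. 9–11, "by the evident pro-`Σ̂` analogue of [SemiAnbd], Corollary 2.7, (i)"), for ANY profinite
completion `ι` of a chart and ANY decomposition subgroup of a CONNECTED `ℍ` with a vertex — abc-iut-w5-d240's
(P3) theorem with its three `ℍ`-side / p. 44 binders `h36'`, `hq`, `hel` DERIVED from the Prop. 3.6 bundle
of `𝒢` (§3, §4). [cite: Mochizuki2012, IUTchI Prop 2.2 p.46] -/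
theorem isCommensurablyTerminal_topologicalClosure_map_of_mem_decompSubgroups_of_prop36
    (h36 : 𝒢.Prop36Hypotheses) (hconn : (𝒢.restrict H).IsConnected) (hv : (𝒢.restrict H).HasVertex)
    (c : TemperedPiChart 𝒢) {P : Type*} [Group P] [TopologicalSpace P] [IsTopologicalGroup P]
    {ι : c.G →ₜ* P} (hι : IsProfiniteCompletion ι) {D : Subgroup c.G} (hD : D ∈ c.decompSubgroups H) :
    IsCommensurablyTerminal ((D.map ι.toMonoidHom).topologicalClosure) :=
  isCommensurablyTerminal_topologicalClosure_map_of_mem_decompSubgroups h36 (h36.restrictSub H hconn hv)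
    h36.isQuasiCoherent_toAnab_maximalSubgraph (fun w => h36.isElevated_toAnab_maximalSubgraph w.1) c hι hD

/-- **[IUTchI] Cor. 2.3 (v) input `ι⁻¹(Π̂_ℍ) = Π^tp_ℍ` for EVERY decomposition subgroup of a connected `ℍ`
with a vertex** — abc-iut-w5-d240's (P1) in the `IsInducing` currency with the embedding supplied by the
capstone and the `𝒢_ℍ`-side bundles derived; binders left: the Thm. 3.7 bundle of `𝒢`, COHERENCE of `𝒢`
(M. Hall separability needs finitely generated constituents) and a closed edge of `𝒢`, finiteness.
[cite: Mochizuki2012, IUTchI Cor 2.3(v) pp.49-50] -/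
theorem comap_topologicalClosure_map_eq_of_mem_decompSubgroups_of_isCoherent
    [Finite 𝒢.graph.Vertex] [Finite 𝒢.graph.Edge] [Finite (𝒢.restrict H).graph.Vertex]
    [Finite (𝒢.restrict H).graph.Edge] (h37 : 𝒢.Thm37Hypotheses) (hcoh : 𝒢.IsCoherent)
    (hcl : ∃ e : 𝒢.graph.Edge, 𝒢.graph.IsClosedEdge e) (hconn : (𝒢.restrict H).IsConnected)
    (hv : (𝒢.restrict H).HasVertex) (c : TemperedPiChart 𝒢) {P : Type v} [Group P] [TopologicalSpace P]
    [IsTopologicalGroup P] {ι : c.G →ₜ* P} (hι : IsProfiniteCompletion ι) {D : Subgroup c.G}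
    (hD : D ∈ c.decompSubgroups H) :
    ((D.map ι.toMonoidHom).topologicalClosure).comap ι.toMonoidHom = D := by
  obtain ⟨φ, hφ⟩ := c.decompHomExists H
    ((𝒢.restrict H).temperedPiChart (h37.restrictSub H hconn hv).toProp36Hypotheses)
  exact comap_topologicalClosure_map_eq_of_mem_decompSubgroups_of_isInducing h37.toProp36Hypotheses hcoh hcl
    (h37.toProp36Hypotheses.restrictSub H hconn hv) (hcoh.restrictSub H) c hφ
    (hφ.isInducing h37 (h37.restrictSub H hconn hv)) hι hD

/-- The «`Π̂_ℍ ∩ ι(Π^tp_𝔾) = ι(Π^tp_ℍ)`» set form of the same. [cite: Mochizuki2012, IUTchI Cor 2.3(v) pp.49-50] -/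
theorem topologicalClosure_map_inf_range_eq_of_mem_decompSubgroups_of_isCoherent
    [Finite 𝒢.graph.Vertex] [Finite 𝒢.graph.Edge] [Finite (𝒢.restrict H).graph.Vertex]
    [Finite (𝒢.restrict H).graph.Edge] (h37 : 𝒢.Thm37Hypotheses) (hcoh : 𝒢.IsCoherent)
    (hcl : ∃ e : 𝒢.graph.Edge, 𝒢.graph.IsClosedEdge e) (hconn : (𝒢.restrict H).IsConnected)
    (hv : (𝒢.restrict H).HasVertex) (c : TemperedPiChart 𝒢) {P : Type v} [Group P] [TopologicalSpace P]
    [IsTopologicalGroup P] {ι : c.G →ₜ* P} (hι : IsProfiniteCompletion ι) {D : Subgroup c.G}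
    (hD : D ∈ c.decompSubgroups H) :
    (D.map ι.toMonoidHom).topologicalClosure ⊓ ι.toMonoidHom.range = D.map ι.toMonoidHom :=
  topologicalClosure_map_inf_range_eq_of_mem_decompSubgroups_of_isClosed h37.toProp36Hypotheses hcoh hcl
    (h37.toProp36Hypotheses.restrictSub H hconn hv) (hcoh.restrictSub H) c hι hD
    (isClosed_of_mem_decompSubgroups_of_isConnected h37 hconn hv hD)

/-! ### §6 `hhat` for verticial subgroups (`ℍ` = one vertex) -/

/-- **`hhat` at `ℍ = {v}`: for every VERTICIAL subgroup `Π_v` of a chart and every profinite completion `ι`,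
`closure ι(Π_v)` is commensurably terminal in `Π̂_𝔾`** — the single-vertex edgeless sub-semi-graph `⟨{v}, ∅⟩`
is connected with a vertex (`OneVertexEdgeless.isConnected`) and its decomposition subgroups ARE the verticial
subgroups at `v` (`decompSubgroups_singleVertex_eq_of_prop36`), so §5 applies; binder: the Prop. 3.6 bundle of
`𝒢` only. [cite: Mochizuki2012, IUTchI Prop 2.2 p.46] -/
theorem isCommensurablyTerminal_topologicalClosure_map_of_mem_verticialSubgroups
    (h36 : 𝒢.Prop36Hypotheses) (c : TemperedPiChart 𝒢) {P : Type*} [Group P] [TopologicalSpace P]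
    [IsTopologicalGroup P] {ι : c.G →ₜ* P} (hι : IsProfiniteCompletion ι) {v : 𝒢.graph.Vertex}
    {D : Subgroup c.G} (hD : D ∈ verticialSubgroups c v) :
    IsCommensurablyTerminal ((D.map ι.toMonoidHom).topologicalClosure) := by
  haveI : Unique (𝒢.restrict ⟨{v}, ∅⟩).graph.Vertex :=
    { default := ⟨v, Set.mem_singleton v⟩
      uniq := fun x => Subtype.ext x.2 }
  haveI : IsEmpty (𝒢.restrict ⟨{v}, ∅⟩).graph.Edge := by
    change IsEmpty (↥(∅ : Set 𝒢.graph.Edge))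
    infer_instance
  rw [← decompSubgroups_singleVertex_eq_of_prop36 h36 c v] at hD
  exact isCommensurablyTerminal_topologicalClosure_map_of_mem_decompSubgroups_of_prop36 h36
    (OneVertexEdgeless.isConnected _) ⟨⟨v, Set.mem_singleton v⟩⟩ c hι hD

end TemperedPiChart

end ProfiniteSemiGraph

end Literature.AnabelianGeometry.SemiGraphs

end
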